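import Summits.QuantumFields.YangMills.Theorems.BalabanUVNodesN15CurvedTransporterOrthogonality
import Literature.Barriers.QuantumFields.NoClassicalGlueballsTraceForm
import HarnessLib

/-!
# Route «BalabanUVNodes» (cluster K4 «SpineRates»), Track-A DAG node N15 = NE2, BACKGROUND LAYER — `exp(η ad_a) = Ad_{exp(ηa)}`: dag-n15-c FILE 28's `U ≡ 1` GAUGE
# TRANSPORTS `coordMat e (Φ₀(η, ad_{A_μ(x)}))` ARE THE ADJOINT ACTION `X ↦ U_b X U_b⁻¹` OF THE GROUP ELEMENTS `U_b = exp(ηA_μ(x))` READ IN COORDINATES — Bałaban's (3.50)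
# `R(U_b)` as printed — and the group-level (exponential-free) route to the orthogonality model: ISOMETRIES of the pairing have ORTHOGONAL coordinate matrices

Cell `pub-ymgap`, WIDTH SEAT `pub-ymgap-dag-n15-w2` (director-ym №197 ∕ HUMAN RULING D-0149), generation 2, file 4.  `bears_on: R4∕N15 · K3⁷ SpineGivenEndpointR13SepCoPH
(stmt-QuantumFields-20544)`.  Filed `--kind proof --supports stmt-QuantumFields-20544 --as helper` — COUNT-NEUTRAL; theorems only (0 `def`, 0 `sorry`, 0 `instance`; the
Frobenius structure on `M_N(ℂ)` is Mathlib's SCOPED one as in file 3 p595427); imports BY NAME this seat's file 1 `…N15CurvedTransporterOrthogonality` (p593011: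
`coordMat_apply_single`; through it n15-w3 files 1∕5 `gaugePair`∕`expTrField`, dag-n15-c FILE 28 `gaugeTransport`, n15-b 13a `Phi0`, b2b `adCLM`∕`adL`) and the barrier-catalogue
file `Literature.Barriers.QuantumFields.NoClassicalGlueballsTraceForm` (`traceForm`); sibling of file 3 `…OrthogonalityUN` (same coordinates, the `ad`∕Lie-algebra route); nothing
re-declared.

WHY.  The N15 background-layer lineage MODELS the print's parallel transporter ([Balaban1985BackgroundPropagators] (3.50) p. 400: on a bond `b` the covariant derivative
transports by `R(U_b)`, the ADJOINT action of the bond variable `U_b ∈ G ⊂ U(N)` on `𝔤`; (3.37) p. 396: `U′ = exp(iηA′)`) by the operator exponential `Φ₀(η, ad_a) = exp(η·ad_a)`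
on the fibre algebra `𝔄` (n15-b 13a, FILE 28 `gaugeTransport`, n15-w3 `expTrField`) — «the lineage models `exp(iη ad_{A′})` by `coordMat e (Φ₀ η Z)`» (file 5's header), and
the w-referee's READ of p593011 (pub-ymgap INBOX l.26292) observed that the docstrings' wording conflated the adjoint action `R(U_b)` with that exponential.  THIS FILE PROVES
THE IDENTIFICATION: `exp(η·ad_a) = Ad_{exp(ηa)}`, i.e. `Φ₀(η, ad_a) X = e^{ηa} X e^{−ηa}` in any complete normed algebra — so FILE 28's transport on the bond `(x, x + e_μ)` IS the
adjoint action of the group element `exp(ηA_μ(x))`, read in coordinates, exactly the print's `R(U_b)`; and it adds the exponential-free route to the orthogonality model: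
a pairing-ISOMETRY has an ORTHOGONAL coordinate matrix in orthonormal coordinates, unitary conjugation is a trace-form isometry, hence the site gauge transformations
`W(x) = coordMat e (Ad_{u(x)})` of n15-w3 file 3 (`…N15CurvedGaugeCovariance`, hypotheses `WWᵀ = WᵀW = 1`) are orthogonal for `U(N)`-valued `u`.

WHAT:
* §1 ★ `exp_smul_mul_left` (`exp(η·L_a) = L_{exp(ηa)}` in `𝔄 →L[ℝ] 𝔄`: `NormedSpace.map_exp` along the continuous ring homomorphism `a ↦ L_a`), ★ `exp_smul_mul_right` (`exp(η·R_a)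
  = R_{exp(ηa)}`: the same through the opposite algebra `𝔄ᵐᵒᵖ` and `exp_op`), ★★★ `Phi0_adCLM_eq_mulLeftRight` (`Φ₀(η, ad_a) = mulLeftRight (e^{ηa}) (e^{−ηa})`: `ad_a = L_a − R_a`
  with `L_a`, `R_a` COMMUTING, `exp_add_of_commute`), `Phi0_adCLM_apply` (pointwise `e^{ηa} X e^{−ηa}`), `exp_smul_mul_exp_neg_smul` (`e^{ηa}e^{−ηa} = 1`);
* §2 FILE 28 AS PRINTED: `gaugeTransport_inl_eq_coordMat_conj` ∕ `gaugeTransport_inr_eq_coordMat_conj` (forward ∕ backward transports = coordinates of `X ↦ U X U⁻¹` with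
  `U = e^{ηA_μ(x)}` ∕ `U = e^{−ηA_μ(x − e_μ)}`), `expTrField_ad_eq_coordMat_conj`;
* §3 THE ISOMETRY ROUTE: ★ `coordMat_transpose_mul_self_of_isometry` (`e` orthonormal for a pairing `B`, `T` a `B`-isometry ⟹ `(coordMat e T)ᵀ(coordMat e T) = 1`),
  `coordMat_mul_transpose_self_of_isometry` (Dedekind-finiteness of square matrices), `traceForm_conj_unitary` (`uᴴu = 1 ⟹ ⟨uXuᴴ, uYuᴴ⟩ = ⟨X, Y⟩`, cyclicity),
  ★★ `uN_coordMat_conj_orthogonal` (`coordMat e (X ↦ uXuᴴ)` orthogonal on both sides for unitary `u` in trace-form-orthonormal coordinates);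
* §4 THE PRINT's `R(U_b)` FOR `𝔲(N)`-VALUED FIELDS: `conjTranspose_exp_smul_of_conjTranspose` (`(e^{ηa})ᴴ = e^{−ηa}` for `aᴴ = −a`, Mathlib `star_exp`),
  `exp_smul_unitary_of_conjTranspose` (`(e^{ηa})ᴴ e^{ηa} = 1`), ★★ `uN_gaugeTransport_inl_eq_conj_unitary` (for skew-Hermitian `A_μ(x)` the forward transport is `coordMat e (X ↦ U X Uᴴ)`
  with `U = e^{ηA_μ(x)}` UNITARY — the adjoint action of a group element of `U(N)`, as printed), `uN_gaugeTransport_inl_orthogonal_via_Ad` (orthogonality of the forward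
  transport re-derived through §3 — the exponential-series route of file 1 and the group route agree).

HONEST FRAMING ∕ LIMITS.  Banach-algebra bookkeeping (`exp` along commuting left∕right multiplications, `map_exp`, `exp_op`, `star_exp`) and finite-dimensional linear algebra;
identifies the lineage's MODEL of (3.50) with the print's adjoint action and removes the site-gauge orthogonality hypothesis for unitary gauge transformations; proves NO estimate;
(3.37) p. 396 ∕ (3.50) p. 400 are cited as SHAPES (nothing of [B9] asserted); the η-defects ∕ majorants of `G(U)`, the [B6] gluing and every (3.42)-shaped letter stay displayed
where the lineage has them.  NE2⁺ NOT PRINTED ∕ NOT proved for d = 4; N15 NOT discharged; K3⁷ OPEN, not claimed; counts UNMOVED (typed 28∕28 · discharged 5∕27, A 5∕28); one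
finite 𝕋⁴ at fixed ε — NOT infinite volume, NOT OS on ℝ⁴, NOT a mass gap, NOT Clay; R4 closes the conditional finite-𝕋⁴ rung `BalabanLadder.UV` only.  Restate-immune.
-/

set_option autoImplicit false

noncomputable section
open scoped BigOperators Matrix Matrix.Norms.Frobenius
open Finset NormedSpace

namespace Summit.QuantumFields.YangMills.BalabanUVNodes.N15.CurvedSpecies

open Summit.QuantumFields.YangMills.BalabanUVNodes.N15.MatrixSpecies (Phi0 coordMat basisConst)
open Summit.QuantumFields.YangMills.BalabanUVNodes.N15.BackgroundLayer (gaugeTransport coordMat_one)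
open Literature.MathematicalPhysics.QuantumFieldTheory.Balaban1983to89.Beta.AveragingCorrectionJets (adCLM adCLM_apply adL adL_apply adCLM_eq_adL)
open Literature.Barriers.QuantumFields (traceForm)

/-! ## §1 `exp(η ad_a) = Ad_{exp(ηa)}` in a complete normed algebra -/

section AdExp

variable {𝔄 : Type} [NormedRing 𝔄] [NormedAlgebra ℝ 𝔄] [CompleteSpace 𝔄]

/-- ★ **LEFT MULTIPLICATION EXPONENTIATES TO LEFT MULTIPLICATION BY THE EXPONENTIAL**: `exp(η·L_a) = L_{exp(ηa)}` in the operator algebra `𝔄 →L[ℝ] 𝔄` — `NormedSpace.map_exp`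
along the continuous ring homomorphism `a ↦ L_a = ContinuousLinearMap.mul ℝ 𝔄 a`. [folklore] -/
theorem exp_smul_mul_left (η : ℝ) (a : 𝔄) :
    exp (η • ContinuousLinearMap.mul ℝ 𝔄 a) = ContinuousLinearMap.mul ℝ 𝔄 (exp (η • a)) := by
  letI : NormedAlgebra ℚ 𝔄 := NormedAlgebra.restrictScalars ℚ ℝ 𝔄
  letI : NormedAlgebra ℚ (𝔄 →L[ℝ] 𝔄) := NormedAlgebra.restrictScalars ℚ ℝ (𝔄 →L[ℝ] 𝔄)
  let L : 𝔄 →+* (𝔄 →L[ℝ] 𝔄) :=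
    { toFun := fun b => ContinuousLinearMap.mul ℝ 𝔄 b
      map_one' := by ext x; simp
      map_mul' := fun b c => by ext x; simp [mul_assoc]
      map_zero' := by simp
      map_add' := fun b c => by simp }
  have hL : Continuous L := (ContinuousLinearMap.mul ℝ 𝔄).continuous
  have h := map_exp L hL (η • a)
  have hLs : L (η • a) = η • ContinuousLinearMap.mul ℝ 𝔄 a := by
    show ContinuousLinearMap.mul ℝ 𝔄 (η • a) = _; rw [map_smul]
  rw [hLs] at h
  exact h.symm

/-- ★ **RIGHT MULTIPLICATION EXPONENTIATES TO RIGHT MULTIPLICATION BY THE EXPONENTIAL**: `exp(η·R_a) = R_{exp(ηa)}` — `R : a ↦ (ContinuousLinearMap.mul ℝ 𝔄).flip a` is a ring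
homomorphism from the OPPOSITE algebra `𝔄ᵐᵒᵖ`, and `exp` commutes with `MulOpposite.op` (`NormedSpace.exp_op`). [folklore] -/
theorem exp_smul_mul_right (η : ℝ) (a : 𝔄) :
    exp (η • (ContinuousLinearMap.mul ℝ 𝔄).flip a) = (ContinuousLinearMap.mul ℝ 𝔄).flip (exp (η • a)) := by
  letI : NormedAlgebra ℚ 𝔄 := NormedAlgebra.restrictScalars ℚ ℝ 𝔄
  letI : NormedAlgebra ℚ 𝔄ᵐᵒᵖ := NormedAlgebra.restrictScalars ℚ ℝ 𝔄ᵐᵒᵖ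
  letI : NormedAlgebra ℚ (𝔄 →L[ℝ] 𝔄) := NormedAlgebra.restrictScalars ℚ ℝ (𝔄 →L[ℝ] 𝔄)
  let R : 𝔄ᵐᵒᵖ →+* (𝔄 →L[ℝ] 𝔄) :=
    { toFun := fun b => (ContinuousLinearMap.mul ℝ 𝔄).flip b.unop
      map_one' := by ext x; simp
      map_mul' := fun b c => by ext x; simp [mul_assoc]
      map_zero' := by simp
      map_add' := fun b c => by simp }
  have hR : Continuous R := (ContinuousLinearMap.mul ℝ 𝔄).flip.continuous.comp MulOpposite.continuous_unop
  have h := map_exp R hR (MulOpposite.op (η • a))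
  rw [exp_op] at h
  have h1 : R (MulOpposite.op (exp (η • a))) = (ContinuousLinearMap.mul ℝ 𝔄).flip (exp (η • a)) := rfl
  have h2 : R (MulOpposite.op (η • a)) = η • (ContinuousLinearMap.mul ℝ 𝔄).flip a := by
    show (ContinuousLinearMap.mul ℝ 𝔄).flip (η • a) = _; rw [map_smul]
  rw [h1, h2] at h
  exact h.symm

/-- ★★★ **`exp(η ad_a) = Ad_{exp(ηa)}`**: n15-b's transport species at the generator `ad_a` IS the adjoint action of the group element `exp(ηa)` —
`Φ₀(η, ad_a) = mulLeftRight (e^{ηa}) (e^{−ηa})`, i.e. `X ↦ e^{ηa} X e^{−ηa}`.  Proof: `ad_a = L_a − R_a` with `L_a R_a = R_a L_a` (associativity), so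
`exp(η(L_a − R_a)) = exp(ηL_a) exp(−ηR_a) = L_{e^{ηa}} R_{e^{−ηa}}`.  This is (3.50)'s `R(U_b)` — the adjoint action of `U_b = exp(ηA_μ(x))` on the fibre — for the lineage's
model of the bond variable. [cite: Balaban1985BackgroundPropagators, (3.37) p.396, (3.50) p.400 (shape: `U′ = exp(iηA′)`, adjoint action)] -/
theorem Phi0_adCLM_eq_mulLeftRight (η : ℝ) (a : 𝔄) :
    Phi0 η (adCLM ℝ a) = ContinuousLinearMap.mulLeftRight ℝ 𝔄 (exp (η • a)) (exp (-(η • a))) := by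
  letI : NormedAlgebra ℚ (𝔄 →L[ℝ] 𝔄) := NormedAlgebra.restrictScalars ℚ ℝ (𝔄 →L[ℝ] 𝔄)
  have had : adCLM ℝ a = ContinuousLinearMap.mul ℝ 𝔄 a - (ContinuousLinearMap.mul ℝ 𝔄).flip a := by
    rw [adCLM_eq_adL]; rfl
  have hcomm : Commute (η • ContinuousLinearMap.mul ℝ 𝔄 a) (-(η • (ContinuousLinearMap.mul ℝ 𝔄).flip a)) := by
    refine (Commute.smul_left (Commute.smul_right ?_ η) η).neg_right
    ext x
    simp [mul_assoc]
  unfold Phi0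
  rw [had, smul_sub, sub_eq_add_neg, exp_add_of_commute hcomm, exp_smul_mul_left, ← smul_neg, ← map_neg, exp_smul_mul_right, smul_neg, ← neg_smul]
  ext x
  simp [ContinuousLinearMap.mulLeftRight_apply, mul_assoc]

/-- `Φ₀(η, ad_a) X = e^{ηa} X e^{−ηa}` pointwise. [cite: Balaban1985BackgroundPropagators, (3.50) p.400 (shape)] -/
theorem Phi0_adCLM_apply (η : ℝ) (a x : 𝔄) : Phi0 η (adCLM ℝ a) x = exp (η • a) * x * exp (-(η • a)) := by
  rw [Phi0_adCLM_eq_mulLeftRight, ContinuousLinearMap.mulLeftRight_apply]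

/-- `e^{ηa} e^{−ηa} = 1` and `e^{−ηa} e^{ηa} = 1` (the two exponentials in `Ad_{exp(ηa)}` are mutually inverse). [folklore] -/
theorem exp_smul_mul_exp_neg_smul (η : ℝ) (a : 𝔄) : exp (η • a) * exp (-(η • a)) = 1 ∧ exp (-(η • a)) * exp (η • a) = 1 := by
  letI : NormedAlgebra ℚ 𝔄 := NormedAlgebra.restrictScalars ℚ ℝ 𝔄
  refine ⟨?_, ?_⟩
  · rw [← exp_add_of_commute (Commute.refl (η • a)).neg_right, add_neg_cancel, exp_zero]
  · rw [← exp_add_of_commute (Commute.refl (η • a)).neg_left, neg_add_cancel, exp_zero]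

end AdExp

/-! ## §2 FILE 28's `U ≡ 1` transports and n15-w3's exponential transporter field AS PRINTED: coordinates of the adjoint action -/

section Printed

variable {X J ι : Type} [Fintype ι] [DecidableEq ι] {𝔄 : Type} [NormedRing 𝔄] [NormedAlgebra ℝ 𝔄] [CompleteSpace 𝔄] (e : 𝔄 ≃L[ℝ] (ι → ℝ))
  (η : ℝ) (τ : J → X ≃ X) (A : J → X → 𝔄)

/-- **THE FORWARD `U ≡ 1` TRANSPORT IS THE ADJOINT ACTION OF `U_b = e^{ηA_μ(x)}` IN COORDINATES**: `gaugeTransport … (inl μ) x = coordMat e (X ↦ U_b X U_b⁻¹)`.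
[cite: Balaban1985BackgroundPropagators, (3.50) p.400 (shape: `R(U_b)`)] -/
theorem gaugeTransport_inl_eq_coordMat_conj (μ : J) (x : X) :
    gaugeTransport e τ η A (Sum.inl μ) x = coordMat e (ContinuousLinearMap.mulLeftRight ℝ 𝔄 (exp (η • A μ x)) (exp (-(η • A μ x)))) := by
  simp only [gaugeTransport, Sum.elim_inl]
  rw [Phi0_adCLM_eq_mulLeftRight]

/-- **THE BACKWARD `U ≡ 1` TRANSPORT IS THE ADJOINT ACTION OF `U_b̄ = U_b⁻¹ = e^{−ηA_μ(x − e_μ)}` IN COORDINATES**.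
[cite: Balaban1985BackgroundPropagators, (3.50) p.400 (shape: `R(U_b)`, `U(b̄) = U(b)⁻¹`)] -/
theorem gaugeTransport_inr_eq_coordMat_conj (μ : J) (x : X) :
    gaugeTransport e τ η A (Sum.inr μ) x =
      coordMat e (ContinuousLinearMap.mulLeftRight ℝ 𝔄 (exp (-(η • A μ ((τ μ).symm x)))) (exp (η • A μ ((τ μ).symm x)))) := by
  simp only [gaugeTransport, Sum.elim_inr]
  rw [Phi0_adCLM_eq_mulLeftRight, neg_smul, neg_neg]

/-- n15-w3's exponential transporter field at a generator field `Z_μ(x) = ad_{A_μ(x)}` is the coordinate matrix of the adjoint action of `e^{ηA_μ(x)}`.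
[cite: Balaban1985BackgroundPropagators, (3.50) p.400 (shape)] -/
theorem expTrField_ad_eq_coordMat_conj (μ : J) (x : X) :
    expTrField e η (fun μ x => adCLM ℝ (A μ x)) μ x = coordMat e (ContinuousLinearMap.mulLeftRight ℝ 𝔄 (exp (η • A μ x)) (exp (-(η • A μ x)))) := by
  rw [expTrField_apply, Phi0_adCLM_eq_mulLeftRight]

end Printed

/-! ## §3 The isometry route: pairing-isometries have orthogonal coordinate matrices -/

section Isometry

variable {ι : Type} [Fintype ι] [DecidableEq ι] {𝔄 : Type} [NormedRing 𝔄] [NormedAlgebra ℝ 𝔄] (e : 𝔄 ≃L[ℝ] (ι → ℝ))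

/-- ★ **AN ISOMETRY OF THE PAIRING HAS AN ORTHOGONAL COORDINATE MATRIX**: if `e` is orthonormal for `B` (`B x y = e x ⬝ᵥ e y`) and `T` preserves `B` (`B (T x) (T y) = B x y`)
then `(coordMat e T)ᵀ · coordMat e T = 1`.  (Entry `(i, j)` of the product is `⟨T e⁻¹δ_i, T e⁻¹δ_j⟩_B = ⟨e⁻¹δ_i, e⁻¹δ_j⟩_B = δ_{ij}`.) [folklore] -/
theorem coordMat_transpose_mul_self_of_isometry {B : 𝔄 → 𝔄 → ℝ} (hB : ∀ x y, B x y = e x ⬝ᵥ e y) (T : 𝔄 →L[ℝ] 𝔄) (hT : ∀ x y, B (T x) (T y) = B x y) :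
    (coordMat e T)ᵀ * coordMat e T = 1 := by
  ext i j
  rw [Matrix.mul_apply]
  have hk : ∀ k, (coordMat e T)ᵀ i k * coordMat e T k j = e (T (e.symm (Pi.single i 1))) k * e (T (e.symm (Pi.single j 1))) k := by
    intro k; rw [Matrix.transpose_apply, coordMat_apply_single, coordMat_apply_single]
  simp_rw [hk]
  change e (T (e.symm (Pi.single i 1))) ⬝ᵥ e (T (e.symm (Pi.single j 1))) = _
  rw [← hB, hT, hB, ContinuousLinearEquiv.apply_symm_apply, ContinuousLinearEquiv.apply_symm_apply, single_dotProduct, one_mul, Pi.single_apply,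
    Matrix.one_apply]

/-- … and `coordMat e T · (coordMat e T)ᵀ = 1` as well (square matrices over a field are Dedekind-finite: `mul_eq_one_comm`). [folklore] -/
theorem coordMat_mul_transpose_self_of_isometry {B : 𝔄 → 𝔄 → ℝ} (hB : ∀ x y, B x y = e x ⬝ᵥ e y) (T : 𝔄 →L[ℝ] 𝔄) (hT : ∀ x y, B (T x) (T y) = B x y) :
    coordMat e T * (coordMat e T)ᵀ = 1 :=
  mul_eq_one_comm.mp (coordMat_transpose_mul_self_of_isometry e hB T hT)

end Isometry

section Unitary

variable {n : Type} [Fintype n] [DecidableEq n]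

/-- **UNITARY CONJUGATION IS A TRACE-FORM ISOMETRY**: `uᴴu = 1 ⟹ ⟨uXuᴴ, uYuᴴ⟩ = ⟨X, Y⟩` (`(uXuᴴ)ᴴ(uYuᴴ) = uXᴴ(uᴴu)Yuᴴ`, cyclicity of the trace). [folklore] -/
theorem traceForm_conj_unitary {u : Matrix n n ℂ} (hu : uᴴ * u = 1) (X Y : Matrix n n ℂ) :
    traceForm (u * X * uᴴ) (u * Y * uᴴ) = traceForm X Y := by
  unfold traceForm
  rw [Matrix.conjTranspose_mul, Matrix.conjTranspose_mul, Matrix.conjTranspose_conjTranspose]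
  have h : u * (Xᴴ * uᴴ) * (u * Y * uᴴ) = u * (Xᴴ * Y) * uᴴ := by
    calc u * (Xᴴ * uᴴ) * (u * Y * uᴴ) = u * (Xᴴ * ((uᴴ * u) * (Y * uᴴ))) := by simp only [Matrix.mul_assoc]
      _ = u * (Xᴴ * Y) * uᴴ := by rw [hu, Matrix.one_mul]; simp only [Matrix.mul_assoc]
  rw [h, Matrix.trace_mul_cycle, hu, Matrix.one_mul]

variable {κ : Type} [Fintype κ] [DecidableEq κ] (e : Matrix n n ℂ ≃L[ℝ] (κ → ℝ))

/-- ★★ **UNITARY CONJUGATION HAS AN ORTHOGONAL COORDINATE MATRIX**: in trace-form-orthonormal coordinates, `coordMat e (X ↦ uXuᴴ)` (Mathlib's `mulLeftRight ℝ _ u uᴴ`) is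
orthogonal on both sides for `uᴴu = 1` — n15-w3 file 3's (`…N15CurvedGaugeCovariance`) site gauge transformations `W(x)`, hypotheses `W(x)W(x)ᵀ = W(x)ᵀW(x) = 1`, INHABITED
by `W(x) := coordMat e (Ad_{u(x)})` for every `U(N)`-valued `u`. [cite: Balaban1985BackgroundPropagators, (3.50) p.400 (shape: adjoint action of the gauge group)] -/
theorem uN_coordMat_conj_orthogonal (he : ∀ X Y : Matrix n n ℂ, traceForm X Y = e X ⬝ᵥ e Y) {u : Matrix n n ℂ} (hu : uᴴ * u = 1) :
    (coordMat e (ContinuousLinearMap.mulLeftRight ℝ (Matrix n n ℂ) u uᴴ))ᵀ * coordMat e (ContinuousLinearMap.mulLeftRight ℝ (Matrix n n ℂ) u uᴴ) = 1 ∧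
      coordMat e (ContinuousLinearMap.mulLeftRight ℝ (Matrix n n ℂ) u uᴴ) * (coordMat e (ContinuousLinearMap.mulLeftRight ℝ (Matrix n n ℂ) u uᴴ))ᵀ = 1 :=
  have hT : ∀ X Y : Matrix n n ℂ, traceForm (ContinuousLinearMap.mulLeftRight ℝ (Matrix n n ℂ) u uᴴ X) (ContinuousLinearMap.mulLeftRight ℝ (Matrix n n ℂ) u uᴴ Y) =
      traceForm X Y := fun X Y => by
    rw [ContinuousLinearMap.mulLeftRight_apply, ContinuousLinearMap.mulLeftRight_apply]; exact traceForm_conj_unitary hu X Y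
  ⟨coordMat_transpose_mul_self_of_isometry e he _ hT, coordMat_mul_transpose_self_of_isometry e he _ hT⟩

/-! ## §4 The print's `R(U_b)` for `𝔲(N)`-valued fields: a UNITARY group element acting by conjugation -/

/-- For skew-Hermitian `a` the exponential `e^{ηa}` has `(e^{ηa})ᴴ = e^{−ηa}` (Mathlib `star_exp`; `(ηa)ᴴ = −ηa`). [folklore] -/
theorem conjTranspose_exp_smul_of_conjTranspose {a : Matrix n n ℂ} (ha : aᴴ = -a) (η : ℝ) : (exp (η • a))ᴴ = exp (-(η • a)) := by
  rw [← Matrix.star_eq_conjTranspose, star_exp, star_smul, Matrix.star_eq_conjTranspose, ha, smul_neg, star_trivial]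

/-- For skew-Hermitian `a`, `e^{ηa}` is UNITARY: `(e^{ηa})ᴴ e^{ηa} = 1`. [folklore] -/
theorem exp_smul_unitary_of_conjTranspose {a : Matrix n n ℂ} (ha : aᴴ = -a) (η : ℝ) : (exp (η • a))ᴴ * exp (η • a) = 1 := by
  rw [conjTranspose_exp_smul_of_conjTranspose ha]
  exact (exp_smul_mul_exp_neg_smul η a).2

variable {X J : Type} (η : ℝ) (τ : J → X ≃ X) (A : J → X → Matrix n n ℂ)

/-- ★★ **(3.50) AS PRINTED FOR `𝔲(N)`-VALUED FIELDS**: for skew-Hermitian `A_μ(x)` the forward `U ≡ 1` transport of FILE 28 is the coordinate matrix of the conjugation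
`X ↦ U X Uᴴ` by the UNITARY group element `U = e^{ηA_μ(x)}` (`UᴴU = 1`) — the adjoint action `R(U_b)` of `U_b ∈ U(N)` on the fibre.
[cite: Balaban1985BackgroundPropagators, (3.37) p.396, (3.50) p.400 (shape)] -/
theorem uN_gaugeTransport_inl_eq_conj_unitary (hA : ∀ μ x, (A μ x)ᴴ = -A μ x) (μ : J) (x : X) :
    (exp (η • A μ x))ᴴ * exp (η • A μ x) = 1 ∧
      gaugeTransport e τ η A (Sum.inl μ) x = coordMat e (ContinuousLinearMap.mulLeftRight ℝ (Matrix n n ℂ) (exp (η • A μ x)) (exp (η • A μ x))ᴴ) := by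
  refine ⟨exp_smul_unitary_of_conjTranspose (hA μ x) η, ?_⟩
  rw [conjTranspose_exp_smul_of_conjTranspose (hA μ x)]
  exact gaugeTransport_inl_eq_coordMat_conj e η τ A μ x

/-- **THE TWO ROUTES AGREE**: the forward transport of a `𝔲(N)`-valued field is orthogonal (both sides) ALSO by the group route — unitary conjugation is a trace-form isometry
(§3) — independently of file 1's exponential-series argument (`uN_gaugeTransport_orthogonal` of file 3). [folklore] -/
theorem uN_gaugeTransport_inl_orthogonal_via_Ad (he : ∀ X Y : Matrix n n ℂ, traceForm X Y = e X ⬝ᵥ e Y) (hA : ∀ μ x, (A μ x)ᴴ = -A μ x) (μ : J) (x : X) :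
    (gaugeTransport e τ η A (Sum.inl μ) x)ᵀ * gaugeTransport e τ η A (Sum.inl μ) x = 1 ∧
      gaugeTransport e τ η A (Sum.inl μ) x * (gaugeTransport e τ η A (Sum.inl μ) x)ᵀ = 1 := by
  rw [(uN_gaugeTransport_inl_eq_conj_unitary e η τ A hA μ x).2]
  exact uN_coordMat_conj_orthogonal e he (exp_smul_unitary_of_conjTranspose (hA μ x) η)

end Unitary

end Summit.QuantumFields.YangMills.BalabanUVNodes.N15.CurvedSpecies

end
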